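import Literature.MathematicalPhysics.QuantumLattice.LayeredSystemPartitionFunction
import HarnessLib

/-!
# Decoupled INEQUIVALENT legs at positive temperature: `Z(Σ_k Γ_k H_k) = Π_k Z(H_k)`,
# `Σ_k log Z(H_k) ≤ log Z(Σ_k Γ_k H_k + interleg hoppings) ≤ Σ_k log Z(H_k) + 2|β||Λ₂|Σ|tz|`, and the
# layer-resolved thermal densities of the coupled crystal from the layers' own `log Z`

Topic `Literature/MathematicalPhysics/QuantumLattice` (namespace = path; family `hubbard`). The `T > 0`, FINITE-VOLUME
twin of `InequivalentLayerStackingTransport.lean` and the layer-DEPENDENT version of `LayeredSystemPartitionFunction.lean`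
(identical copies `Σ_k Γ_k H`): here every leg `k` carries ITS OWN `Θ`-even Hamiltonian `H_k` — the inner and outer
planes of a trilayer cuprate with their own `t, t', U` and their own site energy / chemical potential `μ_k = μ − ε_k`
(Mukuda–Shimizu–Iyo–Kitaoka 2012 §2). Setting as in the parent: layer site type `Λ₂`, crystal site type `Λ₃`, legs
`φ_k : Λ₂ ↪ Λ₃` with pairwise disjoint images, interleg hoppings `interlegHopping φ k j t`.

* §1 `decoupledSumOf φ H = Σ_k Γ_{φ_k}(H_k)`: the Gibbs weight factorises (`gibbsWeight_decoupledSumOf`), the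
  tracial state factorises over the legs, hence **`partitionFn_decoupledSumOf`: `Z_β(Σ_k Γ_k H_k) = Π_k Z_β(H_k)`** for
  tiling legs (general `partitionFn_decoupledSumOf_eq` with the dimension factors) and
  **`log_partitionFn_decoupledSumOf`: `log Z = Σ_k log Z(H_k)`**.
* §2 interleg words have zero weight in the decoupled Gibbs state (`gibbsState_decoupledSumOf_fermionEmbed_mul_fermionEmbed`,
  `gibbsState_decoupledSumOf_interlegHopping`), and the Peierls–Bogoliubov bracket gives
  **`log_partitionFn_decoupledSumOf_add_interleg_mem_Icc`**:
  `Σ_k log Z(H_k) ≤ log Z(Σ_k Γ_k H_k + Σ_p W_p) ≤ Σ_k log Z(H_k) + 2|β||Λ₂| Σ_p |tz_p|` — coupling inequivalent legs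
  raises `log Z` by at most the (sharp) norm of the coupling: the crystal's grand potential is the SUM of the layers'
  own grand potentials at their own chemical potentials, up to the allowance.
* §3 changing one leg: `decoupledSumOf_update` (`Σ_i Γ_i H'_i = Σ_i Γ_i H_i + Γ_k X` when `H'_k = H_k + X`); the layer
  number operator `Γ_k N` is Hermitian; **`re_gibbsState_legNumber_mem_Icc`** — THE THERMAL LAYER-DENSITY BRACKET:
  for the COUPLED system with leg Hamiltonians `H_k − μ_k N`,
  `(log Z_k(μ_k) − log Z_k(μ_k − h) − a)/(βh) ≤ ⟨Γ_k N⟩ ≤ (log Z_k(μ_k + h) − log Z_k(μ_k) + a)/(βh)`,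
  `a = 2|β||Λ₂|Σ_p|tz_p|`, `Z_k(ν) = Z_β(H_k − νN)` — the thermal
  occupation of EACH leg of the coupled crystal from the `log Z` of THAT leg alone at three chemical potentials
  (Lieb's bracket: `βh⟨N_k⟩ ≥ log Z(μ) − log Z(μ_k − h)`, `≤ log Z(μ_k + h) − log Z(μ)`, then decoupling).
* §4 the layered `t–t'` Hubbard torus `(ℤ/Lℤ)³` with LAYER-DEPENDENT parameters `t_k, t'_k, U_k, μ_k`
  (`decoupledHubbardTorusOf`, `layeredHubbardTorusOf`): **`log_partitionFn_layeredHubbardTorusOf_mem_Icc`**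
  (`Σ_k log Z₂(k) ≤ log Z₃ ≤ Σ_k log Z₂(k) + 2|β|L²Σ_p|tz_p|`), the per-site grand potential
  `grandPotentialPerSite_layeredHubbardTorusOf_mem_Icc` (`∈ [L⁻¹Σ_k f₂(k) − 2Σ_p|tz_p|/L, L⁻¹Σ_k f₂(k)]`), and the
  thermal layer densities **`density_layer_layeredHubbardTorusOf_mem_Icc`** (per site of layer `k`).

Everything is PROVED; definitions with bodies: `decoupledSumOf`, `decoupledHubbardTorusOf`, `layeredHubbardTorusOf`; no named
fact, no number. HONEST SCOPE: finite volume, every `L` (no thermodynamic limit); grand-canonical legs; the allowance is the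
sharp rung norm `2|t|` per rung pair; nothing here bears on order or a phase word.

## Tree / Mathlib search

REUSED from `LayeredSystemPartitionFunction`: `parityAut_gibbsWeight`, `fermionEmbed_exp`, `pairwise_commute_fermionEmbed`,
`normTrace_noncommProd_fermionEmbed`, `trace_noncommProd_mul_fermionEmbed_mul_fermionEmbed_eq_zero` (all already stated for
leg-DEPENDENT factors), `interlegHopping`, `isHermitian_interlegHopping`, `norm_interlegHopping_le_two_mul`,
`log_partitionFn_add_mem_Icc_of_gibbsState_eq_zero`, `torusLayerLeg`, `disjoint_torusLayerLeg`, `card_orb_fermionTorus_three`;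
`log_partitionFn_sub_mem_Icc` (`GibbsFreeEnergyCouplingConcavity`), `partitionFn_eq_re`, `partitionFn_re_pos`
(`ApproximatingHamiltonianProofs`), `totalNumber_eq_diagonal_card`, `isHermitian_hubbardTorusTT'_sub_mu`, `parityAut_hubbardTorusTT'_sub_mu`;
Mathlib `Matrix.exp_sum_of_commute`, `Finset.noncommProd`, `Real.log_prod`, `Finset.prod_pos`.

## References

* E. H. Lieb, CMP 31 (1973) 327, §V eqs. (5.2)–(5.4) (Peierls–Bogoliubov / Bogoliubov bracket). [cite: Lieb1973, §V eqs. (5.2)–(5.4)]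
* H. Araki, H. Moriya, Rev. Math. Phys. 15 (2003) 93, §4.1 eq. (4.16) (product property of the tracial state), eq. (4.8).
  [cite: ArakiMoriya2003, §4.1 eq. (4.16)]
* O. Bratteli, D. W. Robinson, *OAQSM 2* (1997), §5.2.2. [cite: BratteliRobinsonII1997, §5.2.2]
* H. Mukuda, S. Shimizu, A. Iyo, Y. Kitaoka, J. Phys. Soc. Jpn. 81 (2012) 011008, §2 (inequivalent planes). [cite: MukudaEtAl2012, §2]
* E. Pavarini et al., PRL 87 (2001) 047003, eq. (1). [cite: PavariniEtAl2001, eq. (1)]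
-/

noncomputable section

namespace Literature.MathematicalPhysics.QuantumLattice

open Matrix Finset HubbardWave0
open scoped ComplexOrder BigOperators Matrix.Norms.L2Operator

/-! ### §1. The decoupled sum of leg-dependent Hamiltonians and its partition function -/

section Decoupled

variable {Λ₂ Λ₃ : Type*} [LinearOrder Λ₂] [Fintype Λ₂] [LinearOrder Λ₃] [Fintype Λ₃]
  {K : Type*} [Fintype K] [DecidableEq K]

variable (φ : K → (Λ₂ ↪ Λ₃))

/-- **The decoupled sum of leg-dependent Hamiltonians** `Σ_k Γ_{φ_k}(H_k)`: every leg its own Hamiltonian (inner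
and outer planes), no coupling between legs. [cite: BratteliRobinsonII1997, §5.2.2] -/
def decoupledSumOf (H : K → Matrix (Finset (Orb Λ₂)) (Finset (Orb Λ₂)) ℂ) : Matrix (Finset (Orb Λ₃)) (Finset (Orb Λ₃)) ℂ :=
  ∑ k, fermionEmbed (φ k) (H k)

variable {φ} (hφ : ∀ k j, k ≠ j → Disjoint ((Finset.univ : Finset Λ₂).map (φ k)) ((Finset.univ : Finset Λ₂).map (φ j)))
include hφ

omit [DecidableEq K] in
/-- **The Gibbs weight of the decoupled sum factorises**: `e^{-β Σ_k Γ_k H_k} = Π_k Γ_k(e^{-βH_k})` for `Θ`-even `H_k`.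
[cite: BratteliRobinsonII1997, §5.2.2] -/
theorem gibbsWeight_decoupledSumOf {H : K → Matrix (Finset (Orb Λ₂)) (Finset (Orb Λ₂)) ℂ} (hH : ∀ k, parityAut (H k) = H k)
    (β : ℝ) :
    Matrix.gibbsWeight β (decoupledSumOf φ H) =
      Finset.univ.noncommProd (fun k => fermionEmbed (φ k) (Matrix.gibbsWeight β (H k)))
        (pairwise_commute_fermionEmbed hφ (fun k => parityAut_gibbsWeight (hH k) β) _) := by
  have hsmul : -(β : ℂ) • decoupledSumOf φ H = ∑ k, fermionEmbed (φ k) (-(β : ℂ) • H k) := by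
    rw [decoupledSumOf, Finset.smul_sum]
    exact Finset.sum_congr rfl fun k _ => (map_smul _ _ _).symm
  have hβH : ∀ k, parityAut (-(β : ℂ) • H k) = -(β : ℂ) • H k := fun k => by rw [map_smul, hH k]
  rw [Matrix.gibbsWeight, hsmul, Matrix.exp_sum_of_commute Finset.univ (fun k => fermionEmbed (φ k) (-(β : ℂ) • H k))
    (pairwise_commute_fermionEmbed hφ hβH _)]
  refine Finset.noncommProd_congr rfl (fun k _ => ?_) _
  rw [← fermionEmbed_exp, Matrix.gibbsWeight]

/-- **`Z(Σ_k Γ_k H_k) = 2^{N₃} · Π_k (Z(H_k) / 2^{N₂})`** (`N` = number of orbitals). [cite: ArakiMoriya2003, §4.1 eq. (4.16)] -/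
theorem partitionFn_decoupledSumOf_eq {H : K → Matrix (Finset (Orb Λ₂)) (Finset (Orb Λ₂)) ℂ} (hH : ∀ k, parityAut (H k) = H k)
    (β : ℝ) :
    Matrix.partitionFn β (decoupledSumOf φ H) =
      2 ^ Fintype.card (Orb Λ₃) * ∏ k, (Matrix.partitionFn β (H k) / 2 ^ Fintype.card (Orb Λ₂)) := by
  have h := normTrace_noncommProd_fermionEmbed hφ (fun k => parityAut_gibbsWeight (hH k) β) Finset.univ
  rw [← gibbsWeight_decoupledSumOf hφ hH β, normTrace_apply] at h
  simp only [normTrace_apply] at h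
  simp only [Matrix.partitionFn]
  rw [← h, mul_div_cancel₀ _ (pow_ne_zero _ two_ne_zero)]

/-- **`Z(Σ_k Γ_k H_k) = Π_k Z(H_k)`** when the legs TILE the big system (`N₃ = |K|·N₂`). [cite: ArakiMoriya2003, §4.1 eq. (4.16)] -/
theorem partitionFn_decoupledSumOf {H : K → Matrix (Finset (Orb Λ₂)) (Finset (Orb Λ₂)) ℂ} (hH : ∀ k, parityAut (H k) = H k)
    (hcard : Fintype.card (Orb Λ₃) = Fintype.card K * Fintype.card (Orb Λ₂)) (β : ℝ) :
    Matrix.partitionFn β (decoupledSumOf φ H) = ∏ k, Matrix.partitionFn β (H k) := by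
  rw [partitionFn_decoupledSumOf_eq hφ hH, Finset.prod_div_distrib, Finset.prod_const, Finset.card_univ, hcard,
    ← pow_mul, mul_comm (Fintype.card (Orb Λ₂)) (Fintype.card K), mul_div_cancel₀ _ (pow_ne_zero _ two_ne_zero)]

omit [DecidableEq K] hφ in
/-- The decoupled sum of Hermitian leg Hamiltonians is Hermitian. [cite: BratteliRobinsonII1997, §5.2.2] -/
theorem isHermitian_decoupledSumOf {H : K → Matrix (Finset (Orb Λ₂)) (Finset (Orb Λ₂)) ℂ} (hH : ∀ k, (H k).IsHermitian) :
    (decoupledSumOf φ H).IsHermitian := by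
  unfold Matrix.IsHermitian decoupledSumOf
  rw [Matrix.conjTranspose_sum]
  exact Finset.sum_congr rfl fun k _ => by rw [← fermionEmbed_conjTranspose, (hH k).eq]

/-- **`log Z(Σ_k Γ_k H_k) = Σ_k log Z(H_k)`** (tiling legs, Hermitian `Θ`-even `H_k`). [cite: ArakiMoriya2003, §4.1 eq. (4.16)] -/
theorem log_partitionFn_decoupledSumOf [Nonempty (Finset (Orb Λ₂))] {H : K → Matrix (Finset (Orb Λ₂)) (Finset (Orb Λ₂)) ℂ}
    (hH : ∀ k, (H k).IsHermitian) (hHe : ∀ k, parityAut (H k) = H k)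
    (hcard : Fintype.card (Orb Λ₃) = Fintype.card K * Fintype.card (Orb Λ₂)) (β : ℝ) :
    Real.log (Matrix.partitionFn β (decoupledSumOf φ H)).re = ∑ k, Real.log (Matrix.partitionFn β (H k)).re := by
  rw [partitionFn_decoupledSumOf hφ hHe hcard]
  have hre : (∏ k, Matrix.partitionFn β (H k)) = (((∏ k, (Matrix.partitionFn β (H k)).re : ℝ)) : ℂ) := by
    rw [Complex.ofReal_prod]
    exact Finset.prod_congr rfl fun k _ => partitionFn_eq_re (hH k) β
  rw [hre, Complex.ofReal_re, Real.log_prod]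
  exact fun k _ => (partitionFn_re_pos (hH k) β).ne'

/-! ### §2. Interleg words vanish; the two-sided `log Z` bound for the coupled system -/

/-- **Interleg words have zero expectation in the decoupled Gibbs state** (`k ≠ j`, `Θ`-odd `x`).
[cite: ArakiMoriya2003, §4.1 eq. (4.8)] -/
theorem gibbsState_decoupledSumOf_fermionEmbed_mul_fermionEmbed {H : K → Matrix (Finset (Orb Λ₂)) (Finset (Orb Λ₂)) ℂ}
    (hH : ∀ k, parityAut (H k) = H k) (β : ℝ) {k j : K} (hkj : k ≠ j) {x : Matrix (Finset (Orb Λ₂)) (Finset (Orb Λ₂)) ℂ}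
    (hx : parityAut x = -x) (y : Matrix (Finset (Orb Λ₂)) (Finset (Orb Λ₂)) ℂ) :
    Matrix.gibbsState β (decoupledSumOf φ H) (fermionEmbed (φ k) x * fermionEmbed (φ j) y) = 0 := by
  rw [Matrix.gibbsState_apply, gibbsWeight_decoupledSumOf hφ hH β,
    trace_noncommProd_mul_fermionEmbed_mul_fermionEmbed_eq_zero hφ (fun k => parityAut_gibbsWeight (hH k) β) hkj hx y, mul_zero]

/-- **The interleg hopping has zero expectation in the decoupled Gibbs state** (`k ≠ j`). [cite: ArakiMoriya2003, §4.1 eq. (4.8)] -/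
theorem gibbsState_decoupledSumOf_interlegHopping {H : K → Matrix (Finset (Orb Λ₂)) (Finset (Orb Λ₂)) ℂ}
    (hH : ∀ k, parityAut (H k) = H k) (β : ℝ) {k j : K} (hkj : k ≠ j) (t : ℝ) :
    Matrix.gibbsState β (decoupledSumOf φ H) (interlegHopping φ k j t) = 0 := by
  rw [interlegHopping, map_smul, map_sum]
  refine smul_eq_zero_of_right _ (Finset.sum_eq_zero fun y _ => ?_)
  rw [map_sum]
  refine Finset.sum_eq_zero fun σ _ => ?_
  rw [map_add, gibbsState_decoupledSumOf_fermionEmbed_mul_fermionEmbed hφ hH β hkj (parityAut_creation _),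
    gibbsState_decoupledSumOf_fermionEmbed_mul_fermionEmbed hφ hH β (Ne.symm hkj) (parityAut_creation _), add_zero]

/-- **COUPLED INEQUIVALENT LEGS AT `T > 0`** (tiling legs, Hermitian `Θ`-even `H_k`, interleg pairs `kp p ≠ jp p`):
`Σ_k log Z(H_k) ≤ log Z(Σ_k Γ_k H_k + Σ_p W_p) ≤ Σ_k log Z(H_k) + 2|β|·|Λ₂|·Σ_p |tz p|`. [cite: Lieb1973, §V eqs. (5.2)–(5.4)] -/
theorem log_partitionFn_decoupledSumOf_add_interleg_mem_Icc [Nonempty (Finset (Orb Λ₂))] [Nonempty (Finset (Orb Λ₃))]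
    {H : K → Matrix (Finset (Orb Λ₂)) (Finset (Orb Λ₂)) ℂ}
    (hH : ∀ k, (H k).IsHermitian) (hHe : ∀ k, parityAut (H k) = H k)
    (hcard : Fintype.card (Orb Λ₃) = Fintype.card K * Fintype.card (Orb Λ₂))
    {P : Type*} [Fintype P] (kp jp : P → K) (hne : ∀ p, kp p ≠ jp p) (tz : P → ℝ) (β : ℝ) :
    Real.log (Matrix.partitionFn β (decoupledSumOf φ H + ∑ p, interlegHopping φ (kp p) (jp p) (tz p))).re ∈
      Set.Icc (∑ k, Real.log (Matrix.partitionFn β (H k)).re)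
        (∑ k, Real.log (Matrix.partitionFn β (H k)).re + |β| * (2 * Fintype.card Λ₂ * ∑ p, |tz p|)) := by
  have hW : (∑ p, interlegHopping φ (kp p) (jp p) (tz p)).IsHermitian := by
    unfold Matrix.IsHermitian
    rw [Matrix.conjTranspose_sum]
    exact Finset.sum_congr rfl fun p _ => (isHermitian_interlegHopping (kp p) (jp p) (tz p)).eq
  have h0 : Matrix.gibbsState β (decoupledSumOf φ H) (∑ p, interlegHopping φ (kp p) (jp p) (tz p)) = 0 := by
    rw [map_sum]
    exact Finset.sum_eq_zero fun p _ => gibbsState_decoupledSumOf_interlegHopping hφ hHe β (hne p) (tz p)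
  have h := log_partitionFn_add_mem_Icc_of_gibbsState_eq_zero (isHermitian_decoupledSumOf (φ := φ) hH) hW β h0
  rw [log_partitionFn_decoupledSumOf hφ hH hHe hcard] at h
  have hnorm : ‖∑ p, interlegHopping φ (kp p) (jp p) (tz p)‖ ≤ 2 * Fintype.card Λ₂ * ∑ p, |tz p| := by
    refine (norm_sum_le _ _).trans ?_
    rw [Finset.mul_sum]
    refine Finset.sum_le_sum fun p _ => (norm_interlegHopping_le_two_mul hφ (hne p) (tz p)).trans (le_of_eq (by ring))
  exact ⟨h.1, h.2.trans (by nlinarith [abs_nonneg β])⟩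

/-! ### §3. Changing one leg; the layer number operator; thermal layer-density brackets -/

omit hφ in
/-- **Changing the Hamiltonian of one leg**: `Σ_i Γ_i (update H k (H k + X) i) = Σ_i Γ_i H_i + Γ_k X`.
[cite: BratteliRobinsonII1997, §5.2.2] -/
theorem decoupledSumOf_update (H : K → Matrix (Finset (Orb Λ₂)) (Finset (Orb Λ₂)) ℂ) (k : K)
    (X : Matrix (Finset (Orb Λ₂)) (Finset (Orb Λ₂)) ℂ) :
    decoupledSumOf φ (Function.update H k (H k + X)) = decoupledSumOf φ H + fermionEmbed (φ k) X := by
  unfold decoupledSumOf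
  rw [← Finset.add_sum_erase _ _ (Finset.mem_univ k), ← Finset.add_sum_erase _ (fun i => fermionEmbed (φ i) (H i))
    (Finset.mem_univ k), Function.update_self, map_add]
  have hrest : ∑ i ∈ Finset.univ.erase k, fermionEmbed (φ i) (Function.update H k (H k + X) i) =
      ∑ i ∈ Finset.univ.erase k, fermionEmbed (φ i) (H i) :=
    Finset.sum_congr rfl fun i hi => by rw [Function.update_of_ne (Finset.ne_of_mem_erase hi)]
  rw [hrest]
  abel

omit [Fintype K] [DecidableEq K] hφ in
/-- **The number operator of the leg `k`**, `Γ_k N`, is Hermitian. [cite: BratteliRobinsonII1997, §5.2.2] -/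
theorem isHermitian_fermionEmbed_totalNumber (k : K) :
    (fermionEmbed (φ k) (totalNumber : Matrix (Finset (Orb Λ₂)) (Finset (Orb Λ₂)) ℂ)).IsHermitian := by
  have hN : (totalNumber : Matrix (Finset (Orb Λ₂)) (Finset (Orb Λ₂)) ℂ)ᴴ = totalNumber := by
    rw [totalNumber_eq_diagonal_card, Matrix.diagonal_conjTranspose]
    congr 1
    funext s
    simp
  unfold Matrix.IsHermitian
  rw [← fermionEmbed_conjTranspose, hN]

omit [Fintype K] [DecidableEq K] hφ in
/-- A real multiple of the leg number operator is Hermitian. [cite: BratteliRobinsonII1997, §5.2.2] -/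
theorem isHermitian_real_smul_fermionEmbed_totalNumber (k : K) (h : ℝ) :
    ((h : ℂ) • fermionEmbed (φ k) (totalNumber : Matrix (Finset (Orb Λ₂)) (Finset (Orb Λ₂)) ℂ)).IsHermitian := by
  unfold Matrix.IsHermitian
  rw [Matrix.conjTranspose_smul, (isHermitian_fermionEmbed_totalNumber (φ := φ) k).eq, Complex.star_def, Complex.conj_ofReal]

omit [Fintype K] [DecidableEq K] hφ in
/-- **LIEB'S BRACKET FOR THE OCCUPATION OF ONE LEG** of any Hermitian Hamiltonian `H` on the crystal:
`log Z(H) − log Z(H + hΓ_kN) ≤ βh·Re⟨Γ_k N⟩_{β,H} ≤ log Z(H − hΓ_kN) − log Z(H)` (lowering / raising the chemical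
potential of the leg `k` by `h`). [cite: Lieb1973, §V eqs. (5.2)–(5.4)] -/
theorem mul_re_gibbsState_legNumber_mem_Icc [Nonempty (Finset (Orb Λ₃))] {H : Matrix (Finset (Orb Λ₃)) (Finset (Orb Λ₃)) ℂ}
    (hH : H.IsHermitian) (β h : ℝ) (k : K) :
    β * h * (Matrix.gibbsState β H (fermionEmbed (φ k) totalNumber)).re ∈
      Set.Icc (Real.log (Matrix.partitionFn β H).re -
          Real.log (Matrix.partitionFn β (H + (h : ℂ) • fermionEmbed (φ k) totalNumber)).re)
        (Real.log (Matrix.partitionFn β (H - (h : ℂ) • fermionEmbed (φ k) totalNumber)).re -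
          Real.log (Matrix.partitionFn β H).re) := by
  have hW := isHermitian_real_smul_fermionEmbed_totalNumber (φ := φ) k h
  constructor
  · have h1 := (log_partitionFn_sub_mem_Icc hH hW β).2
    rw [map_smul, smul_eq_mul, Complex.re_ofReal_mul] at h1
    linarith
  · have hH' : (H - (h : ℂ) • fermionEmbed (φ k) totalNumber).IsHermitian := hH.sub hW
    have h2 := (log_partitionFn_sub_mem_Icc hH' hW β).1
    rw [sub_add_cancel, map_smul, smul_eq_mul, Complex.re_ofReal_mul] at h2
    linarith

/-- **THERMAL LAYER-DENSITY BRACKET FROM THE LAYER'S OWN `log Z`.** Coupled crystal with leg Hamiltonians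
`H_k − μ_k N` (tiling legs, Hermitian `Θ`-even `H_k`) and any interleg hopping pattern; write
`Z_k(ν) = Z_β(H_k − νN)` and `a = |β|·2|Λ₂|·Σ_p|tz_p|`. Then for every `h > 0` the thermal occupation of the leg `k`
satisfies `log Z_k(μ_k) − log Z_k(μ_k − h) − a ≤ βh·Re⟨Γ_k N⟩ ≤ log Z_k(μ_k + h) − log Z_k(μ_k) + a` — from the 2D
partition functions of THAT layer alone at three chemical potentials. [cite: Lieb1973, §V eqs. (5.2)–(5.4)] -/
theorem mul_re_gibbsState_legNumber_mem_Icc_of_decoupled [Nonempty (Finset (Orb Λ₂))] [Nonempty (Finset (Orb Λ₃))]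
    {H : K → Matrix (Finset (Orb Λ₂)) (Finset (Orb Λ₂)) ℂ} (hH : ∀ k, (H k).IsHermitian) (hHe : ∀ k, parityAut (H k) = H k)
    (hN : parityAut (totalNumber : Matrix (Finset (Orb Λ₂)) (Finset (Orb Λ₂)) ℂ) = totalNumber)
    (hcard : Fintype.card (Orb Λ₃) = Fintype.card K * Fintype.card (Orb Λ₂))
    {P : Type*} [Fintype P] (kp jp : P → K) (hne : ∀ p, kp p ≠ jp p) (tz : P → ℝ) (μ : K → ℝ) (β : ℝ) (k : K)
    {h : ℝ} :
    β * h * (Matrix.gibbsState β (decoupledSumOf φ (fun i => H i - (μ i : ℂ) • totalNumber) +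
        ∑ p, interlegHopping φ (kp p) (jp p) (tz p)) (fermionEmbed (φ k) totalNumber)).re ∈
      Set.Icc
        (Real.log (Matrix.partitionFn β (H k - (μ k : ℂ) • totalNumber)).re -
            Real.log (Matrix.partitionFn β (H k - ((μ k - h : ℝ) : ℂ) • totalNumber)).re -
          |β| * (2 * Fintype.card Λ₂ * ∑ p, |tz p|))
        (Real.log (Matrix.partitionFn β (H k - ((μ k + h : ℝ) : ℂ) • totalNumber)).re -
            Real.log (Matrix.partitionFn β (H k - (μ k : ℂ) • totalNumber)).re +
          |β| * (2 * Fintype.card Λ₂ * ∑ p, |tz p|)) := by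
  -- the three decoupled systems: chemical potentials `μ`, `μ - h e_k`, `μ + h e_k`
  set W := ∑ p, interlegHopping φ (kp p) (jp p) (tz p) with hWdef
  have hHμ : ∀ (ν : K → ℝ) (i : K), (H i - (ν i : ℂ) • totalNumber).IsHermitian := fun ν i =>
    (hH i).sub (by
      unfold Matrix.IsHermitian
      have hNh : (totalNumber : Matrix (Finset (Orb Λ₂)) (Finset (Orb Λ₂)) ℂ)ᴴ = totalNumber := by
        rw [totalNumber_eq_diagonal_card, Matrix.diagonal_conjTranspose]; congr 1; funext s; simp
      rw [Matrix.conjTranspose_smul, hNh, Complex.star_def, Complex.conj_ofReal])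
  have hHμe : ∀ (ν : K → ℝ) (i : K), parityAut (H i - (ν i : ℂ) • totalNumber) = H i - (ν i : ℂ) • totalNumber :=
    fun ν i => by rw [map_sub, map_smul, hHe, hN]
  have hcoupled : ∀ ν : K → ℝ, (decoupledSumOf φ (fun i => H i - (ν i : ℂ) • totalNumber) + W).IsHermitian := fun ν => by
    refine (isHermitian_decoupledSumOf (φ := φ) (hHμ ν)).add ?_
    unfold Matrix.IsHermitian
    rw [hWdef, Matrix.conjTranspose_sum]
    exact Finset.sum_congr rfl fun p _ => (isHermitian_interlegHopping (kp p) (jp p) (tz p)).eq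
  -- the perturbed Hamiltonians are the coupled systems at `μ ∓ h e_k`
  have hplus : decoupledSumOf φ (fun i => H i - (μ i : ℂ) • totalNumber) + W + (h : ℂ) • fermionEmbed (φ k) totalNumber =
      decoupledSumOf φ (fun i => H i - ((Function.update μ k (μ k - h) i : ℝ) : ℂ) • totalNumber) + W := by
    have hfun : (fun i => H i - ((Function.update μ k (μ k - h) i : ℝ) : ℂ) • totalNumber) =
        Function.update (fun i => H i - (μ i : ℂ) • totalNumber) k
          ((H k - (μ k : ℂ) • totalNumber) + (h : ℂ) • totalNumber) := by
      funext i
      by_cases hi : i = k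
      · subst hi
        rw [Function.update_self, Function.update_self, Complex.ofReal_sub, sub_smul]
        abel
      · rw [Function.update_of_ne hi, Function.update_of_ne hi]
    rw [hfun, decoupledSumOf_update, map_smul]
    abel
  have hminus : decoupledSumOf φ (fun i => H i - (μ i : ℂ) • totalNumber) + W - (h : ℂ) • fermionEmbed (φ k) totalNumber =
      decoupledSumOf φ (fun i => H i - ((Function.update μ k (μ k + h) i : ℝ) : ℂ) • totalNumber) + W := by
    have hfun : (fun i => H i - ((Function.update μ k (μ k + h) i : ℝ) : ℂ) • totalNumber) =
        Function.update (fun i => H i - (μ i : ℂ) • totalNumber) k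
          ((H k - (μ k : ℂ) • totalNumber) + (-(h : ℂ)) • totalNumber) := by
      funext i
      by_cases hi : i = k
      · subst hi
        rw [Function.update_self, Function.update_self, Complex.ofReal_add, add_smul, neg_smul]
        abel
      · rw [Function.update_of_ne hi, Function.update_of_ne hi]
    rw [hfun, decoupledSumOf_update, map_smul, neg_smul]
    abel
  have hb := mul_re_gibbsState_legNumber_mem_Icc (φ := φ) (hcoupled μ) β h k
  rw [hplus, hminus] at hb
  -- decoupling of the three log Z's
  have h0 := log_partitionFn_decoupledSumOf_add_interleg_mem_Icc hφ (hHμ μ) (hHμe μ) hcard kp jp hne tz β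
  have h1 := log_partitionFn_decoupledSumOf_add_interleg_mem_Icc hφ (hHμ (Function.update μ k (μ k - h)))
    (hHμe (Function.update μ k (μ k - h))) hcard kp jp hne tz β
  have h2 := log_partitionFn_decoupledSumOf_add_interleg_mem_Icc hφ (hHμ (Function.update μ k (μ k + h)))
    (hHμe (Function.update μ k (μ k + h))) hcard kp jp hne tz β
  -- the decoupled sums differ only in the `k`-th term
  have hsum1 : ∑ i, Real.log (Matrix.partitionFn β (H i - ((Function.update μ k (μ k - h) i : ℝ) : ℂ) • totalNumber)).re =
      ∑ i, Real.log (Matrix.partitionFn β (H i - (μ i : ℂ) • totalNumber)).re -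
        Real.log (Matrix.partitionFn β (H k - (μ k : ℂ) • totalNumber)).re +
        Real.log (Matrix.partitionFn β (H k - ((μ k - h : ℝ) : ℂ) • totalNumber)).re := by
    rw [← Finset.add_sum_erase _ _ (Finset.mem_univ k), ← Finset.add_sum_erase _
      (fun i => Real.log (Matrix.partitionFn β (H i - (μ i : ℂ) • totalNumber)).re) (Finset.mem_univ k),
      Function.update_self]
    have : ∑ i ∈ Finset.univ.erase k, Real.log (Matrix.partitionFn β
        (H i - ((Function.update μ k (μ k - h) i : ℝ) : ℂ) • totalNumber)).re =
        ∑ i ∈ Finset.univ.erase k, Real.log (Matrix.partitionFn β (H i - (μ i : ℂ) • totalNumber)).re :=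
      Finset.sum_congr rfl fun i hi => by rw [Function.update_of_ne (Finset.ne_of_mem_erase hi)]
    rw [this]
    ring
  have hsum2 : ∑ i, Real.log (Matrix.partitionFn β (H i - ((Function.update μ k (μ k + h) i : ℝ) : ℂ) • totalNumber)).re =
      ∑ i, Real.log (Matrix.partitionFn β (H i - (μ i : ℂ) • totalNumber)).re -
        Real.log (Matrix.partitionFn β (H k - (μ k : ℂ) • totalNumber)).re +
        Real.log (Matrix.partitionFn β (H k - ((μ k + h : ℝ) : ℂ) • totalNumber)).re := by
    rw [← Finset.add_sum_erase _ _ (Finset.mem_univ k), ← Finset.add_sum_erase _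
      (fun i => Real.log (Matrix.partitionFn β (H i - (μ i : ℂ) • totalNumber)).re) (Finset.mem_univ k),
      Function.update_self]
    have : ∑ i ∈ Finset.univ.erase k, Real.log (Matrix.partitionFn β
        (H i - ((Function.update μ k (μ k + h) i : ℝ) : ℂ) • totalNumber)).re =
        ∑ i ∈ Finset.univ.erase k, Real.log (Matrix.partitionFn β (H i - (μ i : ℂ) • totalNumber)).re :=
      Finset.sum_congr rfl fun i hi => by rw [Function.update_of_ne (Finset.ne_of_mem_erase hi)]
    rw [this]
    ring
  rw [hsum1, ← hWdef] at h1
  rw [hsum2, ← hWdef] at h2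
  rw [← hWdef] at h0
  constructor
  · linarith [hb.1, h0.1, h1.2]
  · linarith [hb.2, h0.1, h2.2]

end Decoupled

/-! ### §4. The layered `t–t'` Hubbard torus with LAYER-DEPENDENT parameters -/

section Torus

variable (L : ℕ)

/-- **The decoupled inequivalent layers of `(ℤ/Lℤ)³`**: layer `k` carries `H^{t_k t'_k U_k}_L − μ_k N_L`.
[cite: MukudaEtAl2012, §2] -/
def decoupledHubbardTorusOf (t t' U μ : Fin L → ℝ) :
    Matrix (Finset (Orb (FermionTorus 3 L))) (Finset (Orb (FermionTorus 3 L))) ℂ :=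
  decoupledSumOf (torusLayerLeg L) fun k => hubbardTorusTT' L (t k) (t' k) (U k) - (μ k : ℂ) • totalNumber

/-- **The layered `t–t'` Hubbard torus with inequivalent layers**: `Σ_k Γ_k(H^{t_k t'_k U_k}_L − μ_k N_L) + Σ_p W_p`.
[cite: MukudaEtAl2012, §2] -/
def layeredHubbardTorusOf (t t' U μ : Fin L → ℝ) {P : Type*} [Fintype P] (kp jp : P → Fin L) (tz : P → ℝ) :
    Matrix (Finset (Orb (FermionTorus 3 L))) (Finset (Orb (FermionTorus 3 L))) ℂ :=
  decoupledHubbardTorusOf L t t' U μ + torusInterlayerHopping L kp jp tz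

/-- **2D TORUS `log Z`'s OF THE LAYERS ⇒ 3D `log Z`, inequivalent layers**: for every `β`, `L`, pattern,
`Σ_k log Z_β(H_L(k) − μ_k N) ≤ log Z_β(layered torus) ≤ Σ_k log Z_β(H_L(k) − μ_k N) + 2|β| L² Σ_p |tz p|`.
[cite: Lieb1973, §V eqs. (5.2)–(5.4)] -/
theorem log_partitionFn_layeredHubbardTorusOf_mem_Icc (t t' U μ : Fin L → ℝ) {P : Type*} [Fintype P]
    (kp jp : P → Fin L) (hne : ∀ p, kp p ≠ jp p) (tz : P → ℝ) (β : ℝ) :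
    Real.log (Matrix.partitionFn β (layeredHubbardTorusOf L t t' U μ kp jp tz)).re ∈
      Set.Icc (∑ k, Real.log (Matrix.partitionFn β (hubbardTorusTT' L (t k) (t' k) (U k) - (μ k : ℂ) • totalNumber)).re)
        (∑ k, Real.log (Matrix.partitionFn β (hubbardTorusTT' L (t k) (t' k) (U k) - (μ k : ℂ) • totalNumber)).re +
          |β| * (2 * (L ^ 2 : ℕ) * ∑ p, |tz p|)) := by
  have h := log_partitionFn_decoupledSumOf_add_interleg_mem_Icc (disjoint_torusLayerLeg L)
    (H := fun k => hubbardTorusTT' L (t k) (t' k) (U k) - (μ k : ℂ) • totalNumber)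
    (fun k => isHermitian_hubbardTorusTT'_sub_mu (L := L) (t k) (t' k) (U k) (μ k))
    (fun k => parityAut_hubbardTorusTT'_sub_mu (L := L) (t k) (t' k) (U k) (μ k))
    (card_orb_fermionTorus_three L) kp jp hne tz β
  have hcard2 : Fintype.card (FermionTorus 2 L) = L ^ 2 := by
    simp only [FermionTorus, Fintype.card_lex, Fintype.card_fun, Fintype.card_fin]
  have e2 : (Fintype.card (FermionTorus 2 L) : ℝ) = ((L ^ 2 : ℕ) : ℝ) := by rw [hcard2]
  rw [e2] at h
  unfold layeredHubbardTorusOf decoupledHubbardTorusOf torusInterlayerHopping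
  convert h using 9

/-- **Per-site form** (`β > 0`): the grand potential per site of the layered torus with inequivalent layers lies in
`[L⁻¹ Σ_k f₂(k) − 2Σ_p|tz p|/L, L⁻¹ Σ_k f₂(k)]`, `f₂(k) = −(βL²)⁻¹ log Z_β(H_L(k) − μ_k N)` the grand potential per site of
the layer `k` ALONE — the MEAN of the layers' own grand potentials, lowered by at most the allowance.
[cite: Lieb1973, §V eqs. (5.2)–(5.4)] -/
theorem grandPotentialPerSite_layeredHubbardTorusOf_mem_Icc (hL : 0 < L) (t t' U μ : Fin L → ℝ) {P : Type*}
    [Fintype P] (kp jp : P → Fin L) (hne : ∀ p, kp p ≠ jp p) (tz : P → ℝ) {β : ℝ} (hβ : 0 < β) :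
    -(Real.log (Matrix.partitionFn β (layeredHubbardTorusOf L t t' U μ kp jp tz)).re) / (β * (L : ℝ) ^ 3) ∈
      Set.Icc
        ((L : ℝ)⁻¹ * ∑ k, (-(Real.log (Matrix.partitionFn β
            (hubbardTorusTT' L (t k) (t' k) (U k) - (μ k : ℂ) • totalNumber)).re) / (β * (L : ℝ) ^ 2)) -
          2 * (∑ p, |tz p|) / L)
        ((L : ℝ)⁻¹ * ∑ k, (-(Real.log (Matrix.partitionFn β
            (hubbardTorusTT' L (t k) (t' k) (U k) - (μ k : ℂ) • totalNumber)).re) / (β * (L : ℝ) ^ 2))) := by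
  have h := log_partitionFn_layeredHubbardTorusOf_mem_Icc L t t' U μ kp jp hne tz β
  rw [abs_of_pos hβ, Nat.cast_pow] at h
  set x := Real.log (Matrix.partitionFn β (layeredHubbardTorusOf L t t' U μ kp jp tz)).re
  set A := ∑ k, Real.log (Matrix.partitionFn β (hubbardTorusTT' L (t k) (t' k) (U k) - (μ k : ℂ) • totalNumber)).re
    with hA
  set S := ∑ p, |tz p|
  have hLr : (0 : ℝ) < L := Nat.cast_pos.2 hL
  have hβL3 : 0 < β * (L : ℝ) ^ 3 := by positivity
  have hmean : (L : ℝ)⁻¹ * ∑ k, (-(Real.log (Matrix.partitionFn β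
      (hubbardTorusTT' L (t k) (t' k) (U k) - (μ k : ℂ) • totalNumber)).re) / (β * (L : ℝ) ^ 2)) =
      -A / (β * (L : ℝ) ^ 3) := by
    rw [hA, ← Finset.sum_div, ← Finset.sum_neg_distrib]
    field_simp
  rw [hmean]
  constructor
  · have h2 : x ≤ A + β * (2 * (L : ℝ) ^ 2 * S) := h.2
    have key : -x / (β * (L : ℝ) ^ 3) - (-A / (β * (L : ℝ) ^ 3) - 2 * S / L) =
        (A + β * (2 * (L : ℝ) ^ 2 * S) - x) / (β * (L : ℝ) ^ 3) := by
      field_simp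
      ring
    have : 0 ≤ -x / (β * (L : ℝ) ^ 3) - (-A / (β * (L : ℝ) ^ 3) - 2 * S / L) := by
      rw [key]; exact div_nonneg (by linarith) hβL3.le
    linarith
  · have h1 : A ≤ x := h.1
    have key : -A / (β * (L : ℝ) ^ 3) - -x / (β * (L : ℝ) ^ 3) = (x - A) / (β * (L : ℝ) ^ 3) := by
      field_simp
      ring
    have : 0 ≤ -A / (β * (L : ℝ) ^ 3) - -x / (β * (L : ℝ) ^ 3) := by
      rw [key]; exact div_nonneg (by linarith) hβL3.le
    linarith

/-- **THERMAL LAYER DENSITIES OF THE TRILAYER-TYPE TORUS** (inner vs outer planes at `T > 0`): for every `β`, `L`,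
pattern, layer `k` and `h > 0`, with `Z₂(k; ν) = Z_β(H_L(k) − νN)` the 2D partition function of the layer `k` ALONE and
`a = |β|·2L²·Σ_p|tz p|`,
`(log Z₂(k; μ_k) − log Z₂(k; μ_k − h) − a)/(βhL²) ≤ ⟨Γ_k N⟩/L² ≤ (log Z₂(k; μ_k + h) − log Z₂(k; μ_k) + a)/(βhL²)`
(stated as the bracket on `βh·Re⟨Γ_k N⟩`). [cite: Lieb1973, §V eqs. (5.2)–(5.4)] -/
theorem mul_re_gibbsState_layerNumber_layeredHubbardTorusOf_mem_Icc (t t' U μ : Fin L → ℝ) {P : Type*} [Fintype P]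
    (kp jp : P → Fin L) (hne : ∀ p, kp p ≠ jp p) (tz : P → ℝ) (β : ℝ) (k : Fin L) (h : ℝ) :
    β * h * (Matrix.gibbsState β (layeredHubbardTorusOf L t t' U μ kp jp tz)
        (fermionEmbed (torusLayerLeg L k) totalNumber)).re ∈
      Set.Icc
        (Real.log (Matrix.partitionFn β (hubbardTorusTT' L (t k) (t' k) (U k) - (μ k : ℂ) • totalNumber)).re -
            Real.log (Matrix.partitionFn β (hubbardTorusTT' L (t k) (t' k) (U k) - ((μ k - h : ℝ) : ℂ) • totalNumber)).re -
          |β| * (2 * (L ^ 2 : ℕ) * ∑ p, |tz p|))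
        (Real.log (Matrix.partitionFn β (hubbardTorusTT' L (t k) (t' k) (U k) - ((μ k + h : ℝ) : ℂ) • totalNumber)).re -
            Real.log (Matrix.partitionFn β (hubbardTorusTT' L (t k) (t' k) (U k) - (μ k : ℂ) • totalNumber)).re +
          |β| * (2 * (L ^ 2 : ℕ) * ∑ p, |tz p|)) := by
  have hb := mul_re_gibbsState_legNumber_mem_Icc_of_decoupled (disjoint_torusLayerLeg L)
    (H := fun k => hubbardTorusTT' L (t k) (t' k) (U k)) (fun k => hubbardTorusTT'_isHermitian L (t k) (t' k) (U k))
    (fun k => by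
      have h1 := parityAut_hubbardTorusTT'_sub_mu (L := L) (t k) (t' k) (U k) 0
      simpa using h1)
    parityAut_totalNumber (card_orb_fermionTorus_three L) kp jp hne tz μ β k (h := h)
  have hcard2 : Fintype.card (FermionTorus 2 L) = L ^ 2 := by
    simp only [FermionTorus, Fintype.card_lex, Fintype.card_fun, Fintype.card_fin]
  have e2 : (Fintype.card (FermionTorus 2 L) : ℝ) = ((L ^ 2 : ℕ) : ℝ) := by rw [hcard2]
  rw [e2] at hb
  unfold layeredHubbardTorusOf decoupledHubbardTorusOf torusInterlayerHopping
  convert hb using 9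

end Torus

end Literature.MathematicalPhysics.QuantumLattice
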